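import Literature.NumberTheory.LFunctions.MoebiusWalshVaughan
import Literature.NumberTheory.LFunctions.MoebiusWalshGeomSums
import Literature.NumberTheory.Sieve.VinogradovExpSumTools
import Mathlib.NumberTheory.Harmonic.Bounds
import HarnessLib

/-!
# Type-II tools for the Möbius–Walsh box sums (Bourgain 2013, §2): carries and refined kernel sums

Topic `Literature/NumberTheory/LFunctions`; a proofs-only companion of `MoebiusWalshVaughan.lean`
(box sums `boxSum T i j α β = ∑_{a ∈ D_i} ∑_{b ∈ D_j} α(a) β(b) w_T(ab)`) and of
`MoebiusWalshVanDerCorput.lean` / `MoebiusWalshGeomSums.lean` (the differencing (2.2) and the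
geometric-sum majorants), on the way to the TYPE-II estimate of J. Bourgain, *Möbius–Walsh
correlation bounds and an estimate of Mauduit and Rivat*, J. Anal. Math. **119** (2013) 147–163
(= arXiv:1109.2784) [Bourgain2013MoebiusWalsh], §2. Everything here is PROVED and elementary; no
definition, no named fact. Contents — the two ingredients of §2 that the files above do not have:

* `testBit_add_eq_of_noCarry`, `natWalsh_mul_natWalsh_add_eq_window`, `card_filter_carry_le` —
  the DIGIT TRUNCATION of Mauduit–Rivat (Bourgain, after (2.2): "comparing the binary expansions of
  `mn` and `mn + ℓm2^K`, the `K` first digits remain and we can assume that also digits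
  `j > K + μ + ρ + ερ` are unchanged provided … we introduce an additional error term", cf. [M-R]
  Lemma 5): if `2^K ∣ δ`, `δ < 2^w` and the digits of `x` in `[w, w + t)` are not all `1`, then `x`
  and `x + δ` have the same binary digits outside `[K, w + t)`, so
  `w_T(x + δ) w_T(x) = w_{T'}(x + δ) w_{T'}(x)` with `T' = T ∩ [K, w + t)`; the exceptional `n`
  (digits of `mn` in `[w, w+t)` all `1`) in an interval `[N₁, N₂)` number at most
  `((N₂ - N₁) m / 2^{w+t} + 2)(2^w / m + 1)` — a case of `card_filter_mod_window_le`, the count of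
  an arithmetic progression `mn + c` in a window modulo `Q`.
* `sum_range_geomBound_add_div_le` — the REFINED full-period kernel sum
  `∑_{j<Q} min(V, 1/(2‖(j+γ)/Q‖)) ≤ 2Q·min(V/Q, 1/(2‖γ‖)) + Q(1 + log Q)`: compared with
  `MoebiusWalsh.sum_range_geomBound_div_add_le` (`≤ 2V + Q(1 + log Q)`), the resonant term is only
  paid when the offset `γ` is close to an integer — the quantitative content of Bourgain's step
  "(2.16) implying also `‖k'ℓ/2^r‖ < L^{1+2ε}2^{-r}` (2.17)", which is what makes the type-II count
  non-trivial near the diagonal `k + k' ≡ 0 (mod 2^r)`; with `sum_Ico_le_of_forall_sum_range_le`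
  (an interval through blocks of length `P`) and `sum_range_comp_mul_mod_eq` (an odd multiplier
  permutes `ℤ/2^e`).

## References

* J. Bourgain, J. Anal. Math. 119 (2013) 147–163, §2, (2.2)–(2.4), (2.16)–(2.17).
  [Bourgain2013MoebiusWalsh]
* C. Mauduit, J. Rivat, Ann. of Math. 171 (2010) 1591–1646, Lemme 5 (carry propagation).
* M. B. Nathanson, *Additive Number Theory: the Classical Bases*, GTM 164, Lemma 4.7 (geometric sums)
  [Nathanson1996].
-/

noncomputable section

open Finset Real

namespace Literature.NumberTheory.LFunctions.MoebiusWalshTypeII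

open Literature.NumberTheory.LFunctions.MoebiusWalshVaughan (natWalsh abs_natWalsh)
open Literature.NumberTheory.LFunctions.MoebiusWalsh (geomBound_add_nat)
open Literature.NumberTheory.Sieve.Vinogradov (distInt geomBound distInt_nonneg distInt_le_half
  distInt_add_int distInt_neg distInt_eq_zero_iff geomBound_le geomBound_le_inv geomBound_nonneg)

/-! ### Points of an arithmetic progression in a window modulo `Q` -/

/-- **Counting an arithmetic progression in a window modulo `Q`.** For `m ≥ 1`, `Q ≥ 1` and
`N₁ ≤ N₂`: `#{n ∈ [N₁, N₂) : (mn + c) mod Q ∈ [u, u + E)} ≤ ((N₂ - N₁) m / Q + 2)(E / m + 1)`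
(the values `mn + c` visit at most `(N₂ - N₁) m / Q + 2` translates `zQ + [u, u + E)` of the
window, and each translate contains at most `E / m + 1` terms of the progression). [folklore] -/
theorem card_filter_mod_window_le {m Q : ℕ} (hm : 0 < m) (hQ : 0 < Q) (c u E : ℕ) {N₁ N₂ : ℕ}
    (hN : N₁ ≤ N₂) :
    (((Ico N₁ N₂).filter fun n => u ≤ (m * n + c) % Q ∧ (m * n + c) % Q < u + E).card : ℝ) ≤
      (((N₂ : ℝ) - N₁) * m / Q + 2) * ((E : ℝ) / m + 1) := by
  classical
  set s := (Ico N₁ N₂).filter fun n => u ≤ (m * n + c) % Q ∧ (m * n + c) % Q < u + E with hs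
  set f : ℕ → ℕ := fun n => (m * n + c) / Q with hf
  -- fibres of `f` on `s` are short
  have hfib : ∀ b ∈ s.image f, (s.filter fun n => f n = b).card ≤ (E - 1) / m + 1 := by
    intro b hb
    set F := s.filter fun n => f n = b with hF
    have hne : F.Nonempty := by
      obtain ⟨n, hn, rfl⟩ := Finset.mem_image.1 hb
      exact ⟨n, Finset.mem_filter.2 ⟨hn, rfl⟩⟩
    have hn₀F : F.min' hne ∈ F := Finset.min'_mem F hne
    have hsub : F ⊆ Icc (F.min' hne) (F.min' hne + (E - 1) / m) := by
      intro n hn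
      have hle0 : F.min' hne ≤ n := Finset.min'_le F n hn
      have h1 := Finset.mem_filter.1 hn
      have h0 := Finset.mem_filter.1 hn₀F
      have hs1 := (Finset.mem_filter.1 h1.1).2
      have hs0 := (Finset.mem_filter.1 h0.1).2
      have hb1 : (m * n + c) / Q = b := h1.2
      have hb0 : (m * F.min' hne + c) / Q = b := h0.2
      have e1 := Nat.div_add_mod (m * n + c) Q
      have e0 := Nat.div_add_mod (m * F.min' hne + c) Q
      rw [hb1] at e1
      rw [hb0] at e0
      have hlt : m * n < m * F.min' hne + E := by omega
      have hmul : m * (n - F.min' hne) ≤ E - 1 := by rw [Nat.mul_sub]; omega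
      have hdiff : n - F.min' hne ≤ (E - 1) / m :=
        (Nat.le_div_iff_mul_le hm).2 (by rw [mul_comm]; exact hmul)
      rw [Finset.mem_Icc]
      generalize (E - 1) / m = X at hdiff ⊢
      exact ⟨hle0, by omega⟩
    calc F.card ≤ (Icc (F.min' hne) (F.min' hne + (E - 1) / m)).card := Finset.card_le_card hsub
      _ = (E - 1) / m + 1 := by rw [Nat.card_Icc]; generalize (E - 1) / m = X; omega
  -- the image of `f` on `s` is short
  have himg : (s.image f).card ≤ m * (N₂ - N₁) / Q + 2 := by
    rcases Nat.eq_or_lt_of_le hN with h | h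
    · have : s = ∅ := by rw [hs, h, Finset.Ico_self, Finset.filter_empty]
      rw [this, Finset.image_empty, Finset.card_empty]; exact Nat.zero_le _
    · have hsub : s.image f ⊆ Icc (f N₁) (f (N₂ - 1)) := by
        intro b hb
        obtain ⟨n, hn, rfl⟩ := Finset.mem_image.1 hb
        have hn' := Finset.mem_Ico.1 (Finset.mem_filter.1 hn).1
        rw [Finset.mem_Icc]
        have h5 : n ≤ N₂ - 1 := by omega
        exact ⟨Nat.div_le_div_right (Nat.add_le_add_right (Nat.mul_le_mul_left m hn'.1) c),
          Nat.div_le_div_right (Nat.add_le_add_right (Nat.mul_le_mul_left m h5) c)⟩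
      have h1 : m * (N₂ - 1) + c = m * (N₂ - 1 - N₁) + (m * N₁ + c) := by
        rw [← add_assoc, ← Nat.mul_add]; congr 2; omega
      have h2 : (m * (N₂ - 1) + c) / Q ≤ m * (N₂ - 1 - N₁) / Q + (m * N₁ + c) / Q + 1 := by
        rw [h1, Nat.add_div hQ]; split_ifs <;> omega
      have h3 : m * (N₂ - 1 - N₁) / Q ≤ m * (N₂ - N₁) / Q :=
        Nat.div_le_div_right (Nat.mul_le_mul_left _ (by omega))
      have h4 : (m * (N₂ - 1) + c) / Q + 1 - (m * N₁ + c) / Q ≤ m * (N₂ - N₁) / Q + 2 := by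
        generalize (m * (N₂ - 1) + c) / Q = A at h2
        generalize (m * N₁ + c) / Q = B at h2
        generalize m * (N₂ - 1 - N₁) / Q = C at h2 h3
        generalize m * (N₂ - N₁) / Q = D at h3
        omega
      calc (s.image f).card ≤ (Icc (f N₁) (f (N₂ - 1))).card := Finset.card_le_card hsub
        _ = (m * (N₂ - 1) + c) / Q + 1 - (m * N₁ + c) / Q := Nat.card_Icc _ _
        _ ≤ m * (N₂ - N₁) / Q + 2 := h4
  -- combine
  have hcard : s.card ≤ ((E - 1) / m + 1) * (s.image f).card :=
    Finset.card_le_mul_card_image s _ hfib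
  have hm0 : (0 : ℝ) < m := by exact_mod_cast hm
  have hQ0 : (0 : ℝ) < Q := by exact_mod_cast hQ
  have hA : (((E - 1) / m + 1 : ℕ) : ℝ) ≤ (E : ℝ) / m + 1 := by
    push_cast
    have h1 : (((E - 1) / m : ℕ) : ℝ) ≤ ((E - 1 : ℕ) : ℝ) / m := Nat.cast_div_le
    have h2 : ((E - 1 : ℕ) : ℝ) ≤ E := by exact_mod_cast Nat.sub_le E 1
    have h3 : ((E - 1 : ℕ) : ℝ) / m ≤ (E : ℝ) / m := div_le_div_of_nonneg_right h2 hm0.le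
    linarith
  have hB : ((m * (N₂ - N₁) / Q + 2 : ℕ) : ℝ) ≤ ((N₂ : ℝ) - N₁) * m / Q + 2 := by
    push_cast
    have h1 : ((m * (N₂ - N₁) / Q : ℕ) : ℝ) ≤ ((m * (N₂ - N₁) : ℕ) : ℝ) / Q := Nat.cast_div_le
    have h2 : ((m * (N₂ - N₁) : ℕ) : ℝ) = ((N₂ : ℝ) - N₁) * m := by
      push_cast [Nat.cast_sub hN]; ring
    rw [h2] at h1
    linarith
  calc (s.card : ℝ) ≤ (((E - 1) / m + 1 : ℕ) : ℝ) * ((s.image f).card : ℝ) := by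
        exact_mod_cast hcard
    _ ≤ ((E : ℝ) / m + 1) * (((N₂ : ℝ) - N₁) * m / Q + 2) := by
        refine mul_le_mul hA (le_trans (by exact_mod_cast himg) hB) (Nat.cast_nonneg _) ?_
        positivity
    _ = (((N₂ : ℝ) - N₁) * m / Q + 2) * ((E : ℝ) / m + 1) := by ring

/-! ### Digit truncation (carries) -/

/-- **No carry beyond `t` digits.** If `2^K ∣ δ`, `δ < 2^w` and the binary digits of `x`
in positions `[w, w + t)` are not all equal to `1` (i.e. `⌊x/2^w⌋ mod 2^t ≠ 2^t - 1`), then `x + δ`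
and `x` have the same binary digits in every position `j ∉ [K, w + t)`. This is the carry
observation behind Bourgain 2013, §2 (after (2.2)) and Mauduit–Rivat, Lemme 5.
[cite: Bourgain2013MoebiusWalsh, §2 (digit comparison after (2.2))] -/
theorem testBit_add_eq_of_noCarry {x δ K w t j : ℕ} (hδ : 2 ^ K ∣ δ)
    (hδw : δ < 2 ^ w) (hgood : (x / 2 ^ w) % 2 ^ t ≠ 2 ^ t - 1) (hj : j < K ∨ w + t ≤ j) :
    (x + δ).testBit j = x.testBit j := by
  rcases hj with hj | hj
  · -- low digits: `x + δ ≡ x (mod 2^K)`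
    have h1 : (x + δ) % 2 ^ K = x % 2 ^ K := by
      obtain ⟨e, he⟩ := hδ
      rw [he, Nat.add_mul_mod_self_left]
    have h2 : ∀ y : ℕ, y.testBit j = (y % 2 ^ K).testBit j := by
      intro y; rw [Nat.testBit_mod_two_pow]; simp [hj]
    rw [h2 (x + δ), h2 x, h1]
  · -- high digits
    set q := x / 2 ^ w with hq
    set r := x % 2 ^ w with hr
    have hx : x = 2 ^ w * q + r := (Nat.div_add_mod x (2 ^ w)).symm
    have hrlt : r < 2 ^ w := Nat.mod_lt _ (Nat.two_pow_pos w)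
    have hj' : j = (j - w) + w := by omega
    rw [hj', ← Nat.testBit_div_two_pow, ← Nat.testBit_div_two_pow, ← hq]
    have hdiv : (x + δ) / 2 ^ w = q + (r + δ) / 2 ^ w := by
      rw [hx, add_assoc, Nat.mul_add_div (Nat.two_pow_pos w)]
    rw [hdiv]
    have hcases : (r + δ) / 2 ^ w = 0 ∨ (r + δ) / 2 ^ w = 1 := by
      have h2 : (r + δ) / 2 ^ w < 2 := by
        rw [Nat.div_lt_iff_lt_mul (Nat.two_pow_pos w)]; omega
      generalize (r + δ) / 2 ^ w = k at h2 ⊢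
      omega
    rcases hcases with h0 | h1
    · rw [h0, add_zero]
    · rw [h1]
      have e : j - w = (j - w - t) + t := by omega
      rw [e, ← Nat.testBit_div_two_pow, ← Nat.testBit_div_two_pow]
      congr 1
      have hq' : q = 2 ^ t * (q / 2 ^ t) + q % 2 ^ t := (Nat.div_add_mod q (2 ^ t)).symm
      have hlt : q % 2 ^ t < 2 ^ t := Nat.mod_lt _ (Nat.two_pow_pos t)
      have hlt' : q % 2 ^ t + 1 < 2 ^ t := by omega
      conv_lhs => rw [hq', add_assoc, Nat.mul_add_div (Nat.two_pow_pos t), Nat.div_eq_of_lt hlt',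
        Nat.add_zero]

/-- `w_T(x)² = 1`. [folklore] -/
theorem natWalsh_mul_self (T : Finset ℕ) (x : ℕ) : natWalsh T x * natWalsh T x = 1 := by
  rw [← abs_mul_abs_self, abs_natWalsh]; norm_num

/-- **Digit truncation of a Walsh product** (Bourgain 2013, §2: "`w_S(mn) w_S(m(n + ℓ2^K))` '='
`w_{S'}(mn) w_{S'}(m(n + ℓ2^K))` with `S' = S ∩ [K, K + μ + ρ']`", up to the carry exceptions): under
the hypotheses of `testBit_add_eq_of_noCarry`,
`w_T(x + δ) w_T(x) = w_{T'}(x + δ) w_{T'}(x)` with `T' = {j ∈ T : K ≤ j < w + t}`.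
[cite: Bourgain2013MoebiusWalsh, §2 (definition of S')] -/
theorem natWalsh_mul_natWalsh_add_eq_window (T : Finset ℕ) {x δ K w t : ℕ}
    (hδ : 2 ^ K ∣ δ) (hδw : δ < 2 ^ w) (hgood : (x / 2 ^ w) % 2 ^ t ≠ 2 ^ t - 1) :
    natWalsh T (x + δ) * natWalsh T x =
      natWalsh (T.filter fun j => K ≤ j ∧ j < w + t) (x + δ) *
        natWalsh (T.filter fun j => K ≤ j ∧ j < w + t) x := by
  set T' := T.filter fun j => K ≤ j ∧ j < w + t with hT'
  set T'' := T.filter fun j => ¬ (K ≤ j ∧ j < w + t) with hT''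
  have hsplit : ∀ y, natWalsh T y = natWalsh T' y * natWalsh T'' y := by
    intro y
    unfold natWalsh
    rw [hT', hT'', Finset.prod_filter_mul_prod_filter_not]
  have hout : natWalsh T'' (x + δ) = natWalsh T'' x := by
    unfold natWalsh
    refine Finset.prod_congr rfl fun j hj => ?_
    have hj' : j < K ∨ w + t ≤ j := by
      have := (Finset.mem_filter.1 hj).2; omega
    rw [testBit_add_eq_of_noCarry hδ hδw hgood hj']
  rw [hsplit (x + δ), hsplit x, hout]
  calc natWalsh T' (x + δ) * natWalsh T'' x * (natWalsh T' x * natWalsh T'' x)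
      = natWalsh T' (x + δ) * natWalsh T' x * (natWalsh T'' x * natWalsh T'' x) := by ring
    _ = natWalsh T' (x + δ) * natWalsh T' x := by rw [natWalsh_mul_self, mul_one]

/-- The carry condition as a window condition modulo `2^{w+t}`:
`⌊y/2^w⌋ mod 2^t = 2^t - 1 ↔ 2^{w+t} - 2^w ≤ y mod 2^{w+t}`. [folklore] -/
theorem carry_iff (y w t : ℕ) :
    (y / 2 ^ w) % 2 ^ t = 2 ^ t - 1 ↔ 2 ^ (w + t) - 2 ^ w ≤ y % 2 ^ (w + t) := by
  rw [pow_add, ← Nat.mod_mul_right_div_self]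
  set z := y % (2 ^ w * 2 ^ t) with hz
  have hzlt : z < 2 ^ w * 2 ^ t := Nat.mod_lt _ (by positivity)
  have hB : 1 ≤ 2 ^ t := Nat.one_le_two_pow
  have hsub : 2 ^ w * 2 ^ t - 2 ^ w = (2 ^ t - 1) * 2 ^ w := by
    rw [Nat.sub_one_mul, mul_comm]
  constructor
  · intro h
    rw [hsub, ← h]
    exact Nat.div_mul_le_self z _
  · intro h
    refine Nat.div_eq_of_lt_le ?_ ?_
    · rw [← hsub]; exact h
    · rw [Nat.sub_add_cancel hB, mul_comm]; exact hzlt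

/-- **Counting the carry exceptions** (the error term "of the order `2^{-ερ}M²N²`" of Bourgain
2013, §2, cf. [M-R] Lemma 5): for `m ≥ 1` and `N₁ ≤ N₂`, the number of `n ∈ [N₁, N₂)` such that
the binary digits of `mn` in positions `[w, w+t)` are all `1` is at most
`((N₂ - N₁) m / 2^{w+t} + 2)(2^w / m + 1)`. [cite: Bourgain2013MoebiusWalsh, §2 (error term after (2.2))] -/
theorem card_filter_carry_le {m : ℕ} (hm : 0 < m) (w t : ℕ) {N₁ N₂ : ℕ} (hN : N₁ ≤ N₂) :
    (((Ico N₁ N₂).filter fun n => (m * n / 2 ^ w) % 2 ^ t = 2 ^ t - 1).card : ℝ) ≤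
      (((N₂ : ℝ) - N₁) * m / (2 : ℝ) ^ (w + t) + 2) * ((2 : ℝ) ^ w / m + 1) := by
  have hQ : 0 < 2 ^ (w + t) := Nat.two_pow_pos _
  have hle : 2 ^ w ≤ 2 ^ (w + t) := Nat.pow_le_pow_right (by norm_num) (by omega)
  have heq : ((Ico N₁ N₂).filter fun n => (m * n / 2 ^ w) % 2 ^ t = 2 ^ t - 1) =
      (Ico N₁ N₂).filter fun n => 2 ^ (w + t) - 2 ^ w ≤ (m * n + 0) % 2 ^ (w + t) ∧
        (m * n + 0) % 2 ^ (w + t) < (2 ^ (w + t) - 2 ^ w) + 2 ^ w := by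
    refine Finset.filter_congr fun n _ => ?_
    rw [carry_iff, add_zero, Nat.sub_add_cancel hle]
    exact ⟨fun h => ⟨h, Nat.mod_lt _ hQ⟩, fun h => h.1⟩
  rw [heq]
  have h := card_filter_mod_window_le hm hQ 0 (2 ^ (w + t) - 2 ^ w) (2 ^ w) hN
  push_cast at h
  exact h

/-! ### Kernel sums for `min (V, 1/(2‖x‖))` -/

/-- `‖nx‖ ≤ n‖x‖` for `n ∈ ℕ`. [folklore] -/
theorem distInt_nat_mul_le (n : ℕ) (x : ℝ) : distInt (n * x) ≤ n * distInt x := by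
  have h := Literature.NumberTheory.Sieve.Vinogradov.distInt_le_abs_sub_int (n * x) (n * round x)
  calc distInt (n * x) ≤ |(n : ℝ) * x - ((n * round x : ℤ) : ℝ)| := h
    _ = n * distInt x := by
        unfold distInt
        rw [← abs_of_nonneg (Nat.cast_nonneg n : (0 : ℝ) ≤ n), ← abs_mul, abs_of_nonneg
          (Nat.cast_nonneg n : (0 : ℝ) ≤ n)]
        congr 1; push_cast; ring

/-- For `0 ≤ p ≤ 1`: `min (p, 1 - p) ≤ ‖p‖`. [folklore] -/
theorem min_le_distInt {p : ℝ} (h0 : 0 ≤ p) (h1 : p ≤ 1) : min p (1 - p) ≤ distInt p := by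
  unfold distInt
  set n := round p with hn
  rcases le_or_gt n 0 with hle | hgt
  · have : (n : ℝ) ≤ 0 := by exact_mod_cast hle
    calc min p (1 - p) ≤ p := min_le_left _ _
      _ ≤ |p - n| := by rw [abs_of_nonneg (by linarith)]; linarith
  · have : (1 : ℝ) ≤ n := by exact_mod_cast hgt
    calc min p (1 - p) ≤ 1 - p := min_le_right _ _
      _ ≤ |p - n| := by rw [abs_of_nonpos (by linarith)]; linarith

/-- **The endpoint (resonant) term**: `min (V, 1/(2‖γ/Q‖)) ≤ Q · min (V/Q, 1/(2‖γ‖))` for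
`Q ≥ 1`, i.e. `≤ min (V, Q/(2‖γ‖))` (from `‖γ‖ ≤ Q‖γ/Q‖`). [folklore] -/
theorem geomBound_div_le (V : ℝ) {Q : ℕ} (hQ : 0 < Q) (γ : ℝ) :
    geomBound V (γ / Q) ≤ Q * geomBound (V / Q) γ := by
  have hQ0 : (0 : ℝ) < Q := by exact_mod_cast hQ
  have hmul : distInt γ ≤ Q * distInt (γ / Q) := by
    have := distInt_nat_mul_le Q (γ / Q)
    rwa [mul_div_cancel₀ _ hQ0.ne'] at this
  by_cases h0 : distInt (γ / Q) = 0
  · -- then `‖γ‖ = 0` as well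
    have hγ : distInt γ = 0 := le_antisymm (by rw [h0, mul_zero] at hmul; exact hmul) (distInt_nonneg _)
    unfold geomBound
    rw [if_pos h0, if_pos hγ, mul_div_cancel₀ _ hQ0.ne']
  · have hpos : 0 < distInt (γ / Q) := lt_of_le_of_ne (distInt_nonneg _) (Ne.symm h0)
    unfold geomBound
    rw [if_neg h0]
    split_ifs with hγ
    · rw [mul_div_cancel₀ _ hQ0.ne']; exact min_le_left _ _
    · have hγpos : 0 < distInt γ := lt_of_le_of_ne (distInt_nonneg _) (Ne.symm hγ)
      rw [mul_min_of_nonneg _ _ hQ0.le, mul_div_cancel₀ _ hQ0.ne']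
      refine min_le_min le_rfl ?_
      rw [mul_one_div, div_le_div_iff₀ (by positivity) (by positivity)]
      nlinarith

/-- **A middle term**: for `Q ≥ 2`, `1 ≤ j ≤ Q - 2` and `0 ≤ γ < 1`,
`min (V, 1/(2‖(j+γ)/Q‖)) ≤ Q/(2j) + Q/(2(Q-1-j))`. [folklore] -/
theorem geomBound_middle_le (V : ℝ) {Q j : ℕ} (hj1 : 1 ≤ j) (hjQ : j + 2 ≤ Q) {γ : ℝ}
    (h0 : 0 ≤ γ) (h1 : γ < 1) :
    geomBound V (((j : ℝ) + γ) / Q) ≤ (Q : ℝ) / (2 * j) + (Q : ℝ) / (2 * ((Q - 1 - j : ℕ) : ℝ)) := by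
  have hQ0 : (0 : ℝ) < Q := by exact_mod_cast (show 0 < Q by omega)
  have hj0 : (0 : ℝ) < j := by exact_mod_cast hj1
  have hk0 : (0 : ℝ) < ((Q - 1 - j : ℕ) : ℝ) := by exact_mod_cast (show 0 < Q - 1 - j by omega)
  have hk : ((Q - 1 - j : ℕ) : ℝ) = (Q : ℝ) - 1 - j := by
    rw [Nat.cast_sub (by omega), Nat.cast_sub (by omega)]; push_cast; ring
  set p := ((j : ℝ) + γ) / Q with hp
  have hp0 : 0 ≤ p := by positivity
  have hp1 : p ≤ 1 := by
    rw [hp, div_le_one hQ0]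
    have : (j : ℝ) + 2 ≤ Q := by exact_mod_cast hjQ
    linarith
  have hd : min ((j : ℝ) / Q) (((Q - 1 - j : ℕ) : ℝ) / Q) ≤ distInt p := by
    refine le_trans ?_ (min_le_distInt hp0 hp1)
    refine min_le_min ?_ ?_
    · rw [hp]; exact div_le_div_of_nonneg_right (by linarith) hQ0.le
    · rw [hp, hk, le_sub_iff_add_le, ← add_div, div_le_one hQ0]; linarith
  have hdpos : 0 < distInt p := lt_of_lt_of_le (lt_min (by positivity) (by positivity)) hd
  calc geomBound V p ≤ 1 / (2 * distInt p) := geomBound_le_inv V hdpos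
    _ ≤ 1 / (2 * min ((j : ℝ) / Q) (((Q - 1 - j : ℕ) : ℝ) / Q)) := by
        apply one_div_le_one_div_of_le (by positivity); linarith
    _ ≤ (Q : ℝ) / (2 * j) + (Q : ℝ) / (2 * ((Q - 1 - j : ℕ) : ℝ)) := by
        rcases le_total ((j : ℝ) / Q) (((Q - 1 - j : ℕ) : ℝ) / Q) with hle | hle
        · rw [min_eq_left hle]
          have : 1 / (2 * ((j : ℝ) / Q)) = (Q : ℝ) / (2 * j) := by field_simp
          rw [this]; linarith [show 0 ≤ (Q : ℝ) / (2 * ((Q - 1 - j : ℕ) : ℝ)) by positivity]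
        · rw [min_eq_right hle]
          have : 1 / (2 * (((Q - 1 - j : ℕ) : ℝ) / Q)) = (Q : ℝ) / (2 * ((Q - 1 - j : ℕ) : ℝ)) := by
            field_simp
          rw [this]; linarith [show 0 ≤ (Q : ℝ) / (2 * j) by positivity]

/-- The harmonic bound `∑_{1 ≤ j < Q} 1/j ≤ 1 + log Q`. [folklore] -/
theorem sum_Ico_one_div_le_log (Q : ℕ) :
    ∑ j ∈ Ico 1 Q, (1 : ℝ) / j ≤ 1 + Real.log Q := by
  rcases Nat.eq_zero_or_pos Q with h | hQ
  · subst h; simp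
  have h := harmonic_le_one_add_log (Q - 1)
  simp only [harmonic_eq_sum_Icc, Rat.cast_sum, Rat.cast_inv, Rat.cast_natCast] at h
  have hI : Icc 1 (Q - 1) = Ico 1 Q := by ext j; simp only [mem_Icc, mem_Ico]; omega
  rw [hI] at h
  simp_rw [one_div]
  refine h.trans ?_
  have : Real.log ((Q - 1 : ℕ) : ℝ) ≤ Real.log Q := by
    rcases Nat.eq_or_lt_of_le hQ with h1 | h1
    · rw [← h1]; simp
    · exact Real.log_le_log (by exact_mod_cast (show 0 < Q - 1 by omega))
        (by exact_mod_cast Nat.sub_le Q 1)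
  linarith

/-- **Kernel sum over one period, offset in `[0, 1)`**: for `Q ≥ 1`, `V ≥ 0`, `0 ≤ γ < 1`,
`∑_{j<Q} min (V, 1/(2‖(j+γ)/Q‖)) ≤ 2Q·min (V/Q, 1/(2‖γ‖)) + Q(1 + log Q)`. [folklore] -/
theorem sum_range_geomBound_add_div_le_of_lt_one {V : ℝ} (hV : 0 ≤ V) {Q : ℕ} (hQ : 0 < Q)
    {γ : ℝ} (h0 : 0 ≤ γ) (h1 : γ < 1) :
    ∑ j ∈ range Q, geomBound V (((j : ℝ) + γ) / Q) ≤
      2 * Q * geomBound (V / Q) γ + Q * (1 + Real.log Q) := by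
  have hQ0 : (0 : ℝ) < Q := by exact_mod_cast hQ
  have hg0 : 0 ≤ geomBound (V / Q) γ := geomBound_nonneg (by positivity) γ
  have hlog : 0 ≤ Real.log Q := Real.log_natCast_nonneg Q
  have hend0 : geomBound V (((0 : ℕ) : ℝ) + γ) / Q ≤ 0 ∨ True := Or.inr trivial
  -- endpoint `j = 0`
  have hE0 : geomBound V ((((0 : ℕ) : ℝ) + γ) / Q) ≤ Q * geomBound (V / Q) γ := by
    rw [Nat.cast_zero, zero_add]; exact geomBound_div_le V hQ γ
  -- endpoint `j = Q - 1`
  have hE1 : geomBound V ((((Q - 1 : ℕ) : ℝ) + γ) / Q) ≤ Q * geomBound (V / Q) γ := by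
    have e : (((Q - 1 : ℕ) : ℝ) + γ) / Q = (γ - 1) / Q + (1 : ℕ) := by
      rw [Nat.cast_sub hQ]; push_cast; field_simp; ring
    rw [e, geomBound_add_nat]
    have h := geomBound_div_le V hQ (γ - 1)
    have e2 : geomBound (V / Q) (γ - 1) = geomBound (V / Q) γ := by
      unfold geomBound
      rw [sub_eq_add_neg, show (-1 : ℝ) = ((-1 : ℤ) : ℝ) by norm_num, distInt_add_int]
    rwa [e2] at h
  rcases Nat.lt_or_ge Q 2 with hQ2 | hQ2
  · -- `Q = 1`
    have hQ1 : Q = 1 := by omega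
    subst hQ1
    rw [Finset.sum_range_one]
    calc geomBound V ((((0 : ℕ) : ℝ) + γ) / ((1 : ℕ) : ℝ)) ≤ (1 : ℕ) * geomBound (V / (1 : ℕ)) γ := hE0
      _ ≤ 2 * ((1 : ℕ) : ℝ) * geomBound (V / ((1 : ℕ) : ℝ)) γ + ((1 : ℕ) : ℝ) * (1 + Real.log ((1 : ℕ) : ℝ)) := by
          push_cast at hg0 ⊢; rw [Real.log_one]; linarith
  · -- `Q ≥ 2`: split off the two endpoints
    have hsplit : range Q = insert 0 (insert (Q - 1) (Ico 1 (Q - 1))) := by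
      ext j; simp only [mem_range, mem_insert, mem_Ico]; omega
    have hn0 : (0 : ℕ) ∉ insert (Q - 1) (Ico 1 (Q - 1)) := by
      simp only [mem_insert, mem_Ico]; omega
    have hn1 : Q - 1 ∉ Ico 1 (Q - 1) := by simp
    rw [hsplit, Finset.sum_insert hn0, Finset.sum_insert hn1]
    have hmid : ∑ j ∈ Ico 1 (Q - 1), geomBound V (((j : ℝ) + γ) / Q) ≤ Q * (1 + Real.log Q) := by
      calc ∑ j ∈ Ico 1 (Q - 1), geomBound V (((j : ℝ) + γ) / Q)
          ≤ ∑ j ∈ Ico 1 (Q - 1), ((Q : ℝ) / (2 * j) + (Q : ℝ) / (2 * ((Q - 1 - j : ℕ) : ℝ))) := by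
            refine Finset.sum_le_sum fun j hj => ?_
            rw [mem_Ico] at hj
            exact geomBound_middle_le V hj.1 (by omega) h0 h1
        _ = (Q : ℝ) / 2 * ∑ j ∈ Ico 1 (Q - 1), (1 : ℝ) / j +
              (Q : ℝ) / 2 * ∑ j ∈ Ico 1 (Q - 1), (1 : ℝ) / ((Q - 1 - j : ℕ) : ℝ) := by
            rw [Finset.sum_add_distrib, Finset.mul_sum, Finset.mul_sum]
            congr 1 <;> refine Finset.sum_congr rfl fun j _ => ?_ <;> field_simp
        _ = (Q : ℝ) * ∑ j ∈ Ico 1 (Q - 1), (1 : ℝ) / j := by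
            have hrefl : ∑ j ∈ Ico 1 (Q - 1), (1 : ℝ) / ((Q - 1 - j : ℕ) : ℝ) =
                ∑ j ∈ Ico 1 (Q - 1), (1 : ℝ) / j := by
              refine Finset.sum_nbij' (fun j => Q - 1 - j) (fun j => Q - 1 - j) ?_ ?_ ?_ ?_ ?_
              · intro a ha; rw [mem_Ico] at ha ⊢; omega
              · intro a ha; rw [mem_Ico] at ha ⊢; omega
              · intro a ha; rw [mem_Ico] at ha; omega
              · intro a ha; rw [mem_Ico] at ha; omega
              · intro a _; rfl
            rw [hrefl]; ring
        _ ≤ (Q : ℝ) * (1 + Real.log Q) := by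
            refine mul_le_mul_of_nonneg_left ?_ hQ0.le
            calc ∑ j ∈ Ico 1 (Q - 1), (1 : ℝ) / j ≤ ∑ j ∈ Ico 1 Q, (1 : ℝ) / j :=
                  Finset.sum_le_sum_of_subset_of_nonneg (Finset.Ico_subset_Ico le_rfl (by omega))
                    fun j _ _ => by positivity
              _ ≤ 1 + Real.log Q := sum_Ico_one_div_le_log Q
    linarith

/-- The kernel sum over one period is `1`-periodic in the offset. [folklore] -/
theorem sum_range_geomBound_add_div_periodic (V : ℝ) {Q : ℕ} (hQ : 0 < Q) :
    Function.Periodic (fun γ : ℝ => ∑ j ∈ range Q, geomBound V (((j : ℝ) + γ) / Q)) 1 := by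
  intro γ
  simp only
  have hQ0 : (0 : ℝ) < Q := by exact_mod_cast hQ
  set f : ℕ → ℝ := fun j => geomBound V (((j : ℝ) + γ) / Q) with hf
  have e : ∀ j : ℕ, geomBound V (((j : ℝ) + (γ + 1)) / Q) = f (j + 1) := by
    intro j; simp only [hf]; push_cast; ring_nf
  rw [Finset.sum_congr rfl fun j _ => e j]
  have h1 := Finset.sum_range_succ' f Q
  have h2 := Finset.sum_range_succ f Q
  have hper : f Q = f 0 := by
    simp only [hf, Nat.cast_zero, zero_add]
    have : ((Q : ℝ) + γ) / Q = γ / Q + (1 : ℕ) := by push_cast; field_simp; ring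
    rw [this, geomBound_add_nat]
  linarith

/-- **Kernel sum over one period with an offset**: for `Q ≥ 1`, `V ≥ 0` and any real `γ`,
`∑_{j<Q} min (V, 1/(2‖(j+γ)/Q‖)) ≤ 2Q·min (V/Q, 1/(2‖γ‖)) + Q(1 + log Q)`. Only the (at most
two) points nearest to an integer can be large, and they are large only when `‖γ‖` is small; the
other `Q - 2` points are `1/Q`-spaced away from the integers and contribute a harmonic sum. This is
the quantitative content of Bourgain 2013, (2.16)–(2.17) ("(2.16) implying also `‖k'ℓ/2^r‖ < …`").
[cite: Bourgain2013MoebiusWalsh, §2 (2.16)–(2.17)] -/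
theorem sum_range_geomBound_add_div_le {V : ℝ} (hV : 0 ≤ V) {Q : ℕ} (hQ : 0 < Q) (γ : ℝ) :
    ∑ j ∈ range Q, geomBound V (((j : ℝ) + γ) / Q) ≤
      2 * Q * geomBound (V / Q) γ + Q * (1 + Real.log Q) := by
  have hper := sum_range_geomBound_add_div_periodic V hQ
  have e1 : (∑ j ∈ range Q, geomBound V (((j : ℝ) + γ) / Q)) =
      ∑ j ∈ range Q, geomBound V (((j : ℝ) + Int.fract γ) / Q) := by
    have := hper.sub_int_mul_eq (x := γ) ⌊γ⌋
    simp only [mul_one] at this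
    rw [← this]; rfl
  have e2 : geomBound (V / Q) γ = geomBound (V / Q) (Int.fract γ) := by
    unfold geomBound
    rw [Int.fract, sub_eq_add_neg, ← Int.cast_neg, distInt_add_int]
  rw [e1, e2]
  exact sum_range_geomBound_add_div_le_of_lt_one hV hQ (Int.fract_nonneg γ) (Int.fract_lt_one γ)

/-! ### Interval sums through blocks; reindexing by odd multipliers -/

/-- **An interval sum through blocks of length `P`**: if `f ≥ 0` and every block sum
`∑_{j<P} f(n₀ + j)` is at most `B`, then `∑_{N₁ ≤ n < N₂} f(n) ≤ ((N₂ - N₁)/P + 1) B`. [folklore] -/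
theorem sum_Ico_le_of_forall_sum_range_le {f : ℕ → ℝ} (hf : ∀ n, 0 ≤ f n) {P : ℕ} (hP : 0 < P)
    {B : ℝ} (hB : ∀ n₀, ∑ j ∈ range P, f (n₀ + j) ≤ B) {N₁ N₂ : ℕ} (hN : N₁ ≤ N₂) :
    ∑ n ∈ Ico N₁ N₂, f n ≤ (((N₂ : ℝ) - N₁) / P + 1) * B := by
  have hB0 : 0 ≤ B := le_trans (Finset.sum_nonneg fun j _ => hf (0 + j)) (hB 0)
  set c := (N₂ - N₁) / P + 1 with hc
  have hlt : N₂ - N₁ < P * c := by rw [hc]; exact Nat.lt_mul_div_succ _ hP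
  have hcover : Ico N₁ N₂ ⊆ Ico N₁ (N₁ + P * c) := Finset.Ico_subset_Ico le_rfl (by omega)
  have hblocks : ∀ k : ℕ, ∑ n ∈ Ico N₁ (N₁ + P * k), f n ≤ k * B := by
    intro k
    induction k with
    | zero => simp
    | succ k ih =>
        rw [← Finset.sum_Ico_consecutive f (Nat.le_add_right N₁ (P * k))
          (by rw [Nat.mul_succ]; omega)]
        have hlast : ∑ n ∈ Ico (N₁ + P * k) (N₁ + P * (k + 1)), f n ≤ B := by
          rw [Finset.sum_Ico_eq_sum_range, show N₁ + P * (k + 1) - (N₁ + P * k) = P by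
            rw [Nat.mul_succ]; omega]
          exact hB _
        push_cast
        linarith
  have hcR : (c : ℝ) ≤ ((N₂ : ℝ) - N₁) / P + 1 := by
    rw [hc]; push_cast
    have : (((N₂ - N₁) / P : ℕ) : ℝ) ≤ ((N₂ - N₁ : ℕ) : ℝ) / P := Nat.cast_div_le
    rw [Nat.cast_sub hN] at this
    linarith
  calc ∑ n ∈ Ico N₁ N₂, f n ≤ ∑ n ∈ Ico N₁ (N₁ + P * c), f n :=
        Finset.sum_le_sum_of_subset_of_nonneg hcover fun n _ _ => hf n
    _ ≤ c * B := hblocks c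
    _ ≤ (((N₂ : ℝ) - N₁) / P + 1) * B := mul_le_mul_of_nonneg_right hcR hB0

/-- **Reindexing by a multiplier coprime to the modulus**: `j ↦ dj mod Q` permutes `{0,…,Q-1}`
when `(d, Q) = 1`, so `∑_{j<Q} g(dj mod Q) = ∑_{j<Q} g(j)`. [folklore] -/
theorem sum_range_comp_mul_mod_eq {Q d : ℕ} (hQ : 0 < Q) (hd : Nat.Coprime d Q) (g : ℕ → ℝ) :
    ∑ j ∈ range Q, g (d * j % Q) = ∑ j ∈ range Q, g j := by
  have hinj : Set.InjOn (fun j => d * j % Q) (range Q : Set ℕ) := by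
    intro j hj j' hj' h
    simp only [Finset.coe_range, Set.mem_Iio] at hj hj'
    have h1 : d * j ≡ d * j' [MOD Q] := h
    have h2 : j ≡ j' [MOD Q] := Nat.ModEq.cancel_left_of_coprime hd.symm h1
    have h3 : j % Q = j' % Q := h2
    rwa [Nat.mod_eq_of_lt hj, Nat.mod_eq_of_lt hj'] at h3
  have himg : (range Q).image (fun j => d * j % Q) = range Q := by
    apply Finset.eq_of_subset_of_card_le
    · intro x hx
      obtain ⟨j, _, rfl⟩ := Finset.mem_image.1 hx
      exact mem_range.2 (Nat.mod_lt _ hQ)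
    · rw [Finset.card_image_of_injOn hinj]
  calc ∑ j ∈ range Q, g (d * j % Q) = ∑ x ∈ (range Q).image (fun j => d * j % Q), g x :=
        (Finset.sum_image hinj).symm
    _ = ∑ j ∈ range Q, g j := by rw [himg]

end Literature.NumberTheory.LFunctions.MoebiusWalshTypeII
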